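import Literature.Geometry.Kaehler.ComplexTorusWeylPairingTransposition
import Literature.Algebra.Lie.LefschetzModuleSL2RepresentationTranspose
import HarnessLib

/-!
# André's Proposition 1.2 at the level of the group on a complex torus: for Voisin's Weyl form `Q_w = (−1)^{k(k−1)/2} ∫_X w(x) ∧ y`,
# THE TRANSPOSE OF BEAUVILLE'S `ρ(γ)` IS `ρ(γᵀ)` for every `γ ∈ SL₂(ℂ)` — `Q_w((ρ(γ)x)_l, y) = Q_w(x, (ρ(γᵀ)y)_k)`; on `H•(X, ℚ)` for `γ ∈ SL₂(ℚ)`;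
# `ρ(γ)` is a `Q_w`-isometry for `γᵀγ = 1`; every element of `ℂ[L_η, Λ_η]` commuting with `H` is `Q_w`-self-adjoint

Layer `Literature/Geometry/Kaehler`, namespace `Literature.Geometry.Kaehler.ComplexTorus`; lane `lit-hodgefound` (Track 2 foundations library, Layer A4), prover
seat `lit-hodgefound-p35` (generation 49, row g49-#2). THEOREMS ONLY (no definition, no named fact, no instance, no notation; D-0026 net debt `0`). The torus
reading of the abstract row g49-#1 `Literature/Algebra/Lie/LefschetzModuleSL2RepresentationTranspose` (for a bilinear form `B` on a Lefschetz module with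
`(e, f)` AND `(f, e)` adjoint pairs — a form OF WEYL TYPE — `B(ρ(γ) x, y) = B(x, ρ(γᵀ) y)` for all `γ ∈ SL₂(K)`, `ρ(γ)` is a `B`-isometry when `γᵀγ = 1`, and
the degree-`0` part of `K[e, f]` is `B`-self-adjoint), sequel of `ComplexTorusWeylPairingTransposition` (row g48-#6: for the Weyl pairing `B_k(x, y) = ∫_X w(x)_t ∧ y`,
`B(Lx, y) = −B(x, Λy)` and `B(Λx, y) = −B(x, Ly)`; Voisin's signs `(−1)^{(a+2)(a+1)/2} = −(−1)^{a(a−1)/2}` turn these into `Q_w(Lx, y) = Q_w(x, Λy)`,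
`Q_w(Λx, y) = Q_w(x, Ly)`). Consumed by name: p09's `sl2Rep` values on the torus (`ComplexTorusLefschetzSL2Action`, `…Lattices`: `ρ(γ)` is defined over `ℚ`
for `γ ∈ SL₂(ℚ)`), p08's `lefschetzG` / `lefschetzDualG` / `countingG` (the Lefschetz `𝔰𝔩₂`-triple `(L_η, Λ_η, H)` on `H•(X; ℂ) = GForm E ℂ`).

THE GRADED WEYL–VOISIN FORM. Inside the proofs (no definition is introduced) the degree-wise forms are assembled into ONE bilinear form on the total space
`H•(X; ℂ)`: `Q(w, w') = Σ_{k ≤ 2g} (−1)^{k(k−1)/2} B_k(w_k, w'_k)` (`exists_gradedWeylForm`); by row g48-#6, `(L_η, Λ_η)` and `(Λ_η, L_η)` are `Q`-ADJOINT PAIRS — `Q` is of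
Weyl type — so the abstract row applies verbatim, and its conclusions are read back on homogeneous components.

## What is proved (`X = E/Λ` a complex torus, `g = dim_ℂ E`, `e : Fin (2g) ≃ ι` a lattice frame, `η` a non-degenerate real `2`-form, `ρ = ρ_η` Beauville's
`SL₂(ℂ)`-action `(hasLefschetzProperty_lefschetzG hη).sl2Rep isZGrading_countingG`, `B_k = weylPairing Φ hη e _` on `Hᵏ(X; ℂ)`, `ε_k = (−1)^{k(k−1)/2}`,
`Q_w^{(k)} = weylPolarizationForm = ε_k B_k` on `Hᵏ(X, ℚ)` for `η ∈ NS(X) ⊗ ℚ`)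

* §1 **`weylPairing_sl2Rep_of_apply_transpose`: `ε_l B_l((ρ(γ)(of k x))_l, y) = ε_k B_k(x, (ρ(γᵀ)(of l y))_k)`** for all `γ ∈ SL(2, ℂ)`, `x ∈ Hᵏ`, `y ∈ Hˡ`
  (`k, l ≤ 2g`) — THE TRANSPOSE OF `ρ(γ)` FOR THE WEYL FORM IS `ρ(γᵀ)`; solved form `weylPairing_sl2Rep_of_apply_eq`; the unipotents
  `weylPairing_exp_smul_lefschetzG_of_apply` (`(e^{aL})ᵀ = e^{aΛ}`: `ε_l B_l((exp(aL_η) x)_l, y) = ε_k B_k(x, (exp(aΛ_η) y)_k)`); powers `weylPairing_lefschetzG_pow_of_apply`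
  (`(Lʲ)ᵀ = Λʲ`); **`sum_weylPairing_sl2Rep_sl2Rep_eq`: for `γᵀγ = 1`, `Σ_{m ≤ 2g} ε_m B_m((ρ(γ)x)_m, (ρ(γ)y)_m) = [k = l] ε_k B_k(x, y)`** (`ρ(γ)` is a `Q`-ISOMETRY:
  the Weyl element, `−1`, the rotations `(a −b ; b a)`).
* §2 **`weylPairing_apply_of_eq_of_mem_adjoin_pair_of_commute`: every `T ∈ ℂ[L_η, Λ_η]` commuting with `H` is `B_k`-SELF-ADJOINT in every degree**:
  `B_k((T(of k x))_k, y) = B_k(x, (T(of k y))_k)` — André: `ℚ[L, ᶜΛ]` "contient les projecteurs de Künneth" and transposition is matrix transposition, so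
  its degree-`0` (block-diagonal-scalar) elements — Kleiman's `pʲ`, the Lefschetz–Künneth projectors `π_{s,r}` (row g48-#9 `weylPairing_primitiveProj_left` is
  the special case), `w²`, the Casimir — are symmetric.
* §3 on `H•(X, ℚ)` (`η ∈ NS(X) ⊗ ℚ`, `γ ∈ SL(2, ℚ)` acting through `SL(2, ℂ)`, `ρ(γ)` defined over `ℚ` by p09's `sl2Rep_map_ratCast_mem_rationalEnd`):
  `sl2Rep_map_ratCast_of_apply_mem_rationalForms`, **`weylPolarizationForm_sl2Rep_of_apply_transpose`: `Q_w((ρ(γ)x)_l, y) = Q_w(x, (ρ(γᵀ)y)_k)`** for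
  `x ∈ Hᵏ(X, ℚ)`, `y ∈ Hˡ(X, ℚ)` — NO SIGN: for Voisin's normalisation transposition is matrix transposition on the nose; `IsNSForm.` reading; the integral
  version `weylPolarizationForm_sl2Rep_intCast_of_apply_transpose` for `γ ∈ SL(2, ℤ)` (Beauville's arithmetic group).

## Sources, VERBATIM

* Y. André, *Pour une théorie inconditionnelle des motifs*, Publ. Math. IHÉS **83** (1996) [Andre1996Motifs] (held `paper:doi-10-1007-bf02698643`), §1.2
  (p. 11 = p0008 L27–L37): "On en déduit une représentation de `𝔰𝔩₂` sur `H•(X)`, attachée à `η` : `ᶜΛ ↦ (0 1 ; 0 0)`, `L ↦ (0 0 ; 1 0)`, `h ↦ (1 0 ; 0 −1)`";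
  (p0008 L54–L55) "l'élément `(0 1 ; −1 0)` de `SL₂` s'envoie sur `± *_H`"; Prop. 1.2 (p0008 L62–L66): "Les sous-algèbres `ℚ[L, *_L]`, `ℚ[L, *_H]`, `ℚ[L, ᶜL, *_L]`,
  `ℚ[L, ᶜΛ]` de `End H(X)` sont égales et contiennent les projecteurs de Künneth. De plus, ces algèbres sont canoniquement isomorphes à une somme d'algèbres
  matricielles […]. Via cet isomorphisme, la transposition relative à la forme bilinéaire `(x, y) ↦ ∫ x ∪ *y` correspond à la transposition des matrices, pour
  `* = *_L` ou `*_H`."; proof (p. 12 = p0009 L13–L15): "il suffit de la tester sur les générateurs `L` et `*_L L *_L`. Comme ces générateurs s'échangent par la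
  transposition, c'est clair."
* A. Beauville, *The action of SL₂ on abelian varieties*, J. Ramanujan Math. Soc. **25** (2010) [Beauville2010SL2], §4 Theorem (held `paper:arxiv-0805.1541`
  p0005 L12–L28): "There is a representation of `SL₂` on `CH(A)` … `(n 0 ; 0 n⁻¹)·z = n^{−g} n^*z`, `(0 −1 ; 1 0)·z = ℱ(z)`, `(1 a ; 0 1)·z = e^{aθ} z`,
  `(1 0 ; a 1)·z = d⁻¹ a^g e^{θ/a} ∗ z`".
* C. Voisin, *Hodge Theory and Complex Algebraic Geometry I* (CUP 2002) [VoisinHodgeI2002], §7.1.2 Def. 7.7 (PDF p. 134: the sign `(−1)^{k(k−1)/2}`).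
* E. Looijenga, V. A. Lunts, *A Lie algebra attached to a projective variety*, Invent. Math. **129** (1997) [LooijengaLunts1997], §1 (1.3) p. 5, (1.7) p. 6.
* H. Lange, *Abelian Varieties over the Complex Numbers* (2023) [Lange2023AbelianVarietiesComplex], §6.2.4 Prop. 6.2.20 (p. 310: Parseval for `F`).

## Scope

Cohomological (invariant-forms) carrier only; the graded form `Q` is packaged privately (an `∃`), the public statements are componentwise identities between the
tree's `weylPairing` / `weylPolarizationForm`; no Chow-theoretic statement.
-/

noncomputable section

-- `Module ℂ` / `SMulZeroClass ℂ` synthesis on `E [⋀^Fin k]→L[ℝ] ℂ` (as in `ComplexTorusLefschetzDecomposition`)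
set_option maxSynthPendingDepth 3

namespace Literature.Geometry.Kaehler

namespace ComplexTorus

open scoped MatrixGroups
open Module Function Finset Complex
open Literature.LinearAlgebra.Alternating Literature.Algebra.Lie Literature.Analysis.Complex

universe uE

variable {ι : Type*} [Fintype ι] [DecidableEq ι] {E : Type uE} [NormedAddCommGroup E] [NormedSpace ℂ E] [FiniteDimensional ℂ E] [Nontrivial E]
  (Φ : (ι → ℝ) ≃L[ℝ] E) {η : E [⋀^Fin 2]→L[ℝ] ℝ} (hη : ∀ v : E, v ≠ 0 → ∃ w : E, η ![v, w] ≠ 0)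

/-! ## §0 The graded Weyl–Voisin form `Q(w, w') = Σ_k (−1)^{k(k−1)/2} B_k(w_k, w'_k)` on `H•(X; ℂ)` (private packaging) -/

section Graded

include Φ in
omit [DecidableEq ι] [FiniteDimensional ℂ E] [Nontrivial E] in
/-- Forms of degree exceeding `2g = dim_ℝ E` vanish. [folklore] -/
private theorem eq_zero_of_two_mul_lt₉₁ {g : ℕ} (e : Fin (2 * g) ≃ ι) {k : ℕ} (hk : 2 * g < k) (φ : E [⋀^Fin k]→L[ℝ] ℂ) : φ = 0 := by
  haveI := finiteDimensional_real Φ e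
  have hN := finrank_real_eq Φ e
  ext v
  have hv : ¬ LinearIndependent ℝ v := fun hli ↦ by
    have := hli.fintype_card_le_finrank
    rw [Fintype.card_fin] at this
    omega
  exact φ.toAlternatingMap.map_linearDependent v hv

omit [Fintype ι] [DecidableEq ι] [NormedAddCommGroup E] [NormedSpace ℂ E] [FiniteDimensional ℂ E] [Nontrivial E] in
/-- `(−1)^{(a+2)(a+1)/2} = −(−1)^{a(a−1)/2}` (`(a+2)(a+1)/2 = a(a−1)/2 + 2a + 1`). [folklore] -/
private theorem neg_one_pow_half_succ_succ₉₁ (a : ℕ) : (-1 : ℂ) ^ ((a + 2) * (a + 2 - 1) / 2) = -(-1) ^ (a * (a - 1) / 2) := by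
  have h : (a + 2) * (a + 2 - 1) / 2 = a * (a - 1) / 2 + (2 * a + 1) := by
    rcases a with _ | b
    · rfl
    · have e1 : b + 1 + 2 - 1 = b + 2 := by omega
      have e2 : b + 1 - 1 = b := by omega
      rw [e1, e2, show (b + 1 + 2) * (b + 2) = (b + 1) * b + 2 * (2 * (b + 1) + 1) by ring, Nat.add_mul_div_left _ _ two_pos]
  rw [h, pow_add, (show Odd (2 * a + 1) from ⟨a, rfl⟩).neg_one_pow, mul_neg, mul_one]

omit [Fintype ι] in
/-- **The graded Weyl–Voisin form** `Q(w, w') = Σ_{k ≤ 2g} (−1)^{k(k−1)/2} B_k(w_k, w'_k)` on `H•(X; ℂ)`: a bilinear form restricting to `ε_k B_k` on equal homogeneous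
degrees and to `0` on distinct ones. [cite: Andre1996Motifs, Prop. 1.2 (p. 11, "(x, y) ↦ ∫ x ∪ *y")] [cite: VoisinHodgeI2002, §7.1.2 Def. 7.7 (PDF p. 134)] -/
private theorem exists_gradedWeylForm₉₁ {g : ℕ} (e : Fin (2 * g) ≃ ι) :
    ∃ Q : LinearMap.BilinForm ℂ (GForm E ℂ),
      (∀ (k t : ℕ) (htk : t + k = 2 * g) (x y : E [⋀^Fin k]→L[ℝ] ℂ),
          Q (GForm.of k x) (GForm.of k y) = (-1 : ℂ) ^ (k * (k - 1) / 2) * weylPairing Φ hη e htk x y) ∧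
      (∀ (k l : ℕ), k ≠ l → ∀ (x : E [⋀^Fin k]→L[ℝ] ℂ) (y : E [⋀^Fin l]→L[ℝ] ℂ), Q (GForm.of k x) (GForm.of l y) = 0) := by
  classical
  refine ⟨∑ k ∈ Finset.range (2 * g + 1), if h : k ≤ 2 * g then
      ((-1 : ℂ) ^ (k * (k - 1) / 2)) • (weylPairing Φ hη e (show (2 * g - k) + k = 2 * g by omega)).compl₁₂
        (LinearMap.proj (R := ℂ) (φ := fun m ↦ E [⋀^Fin m]→L[ℝ] ℂ) k) (LinearMap.proj (R := ℂ) (φ := fun m ↦ E [⋀^Fin m]→L[ℝ] ℂ) k) else 0,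
    fun k t htk x y ↦ ?_, fun k l hkl x y ↦ ?_⟩
  · obtain rfl : t = 2 * g - k := by omega
    simp only [LinearMap.sum_apply]
    rw [Finset.sum_eq_single_of_mem k (Finset.mem_range.2 (by omega)) fun k' _ hk' ↦ ?_]
    · rw [dif_pos (by omega), LinearMap.smul_apply, LinearMap.smul_apply, LinearMap.compl₁₂_apply, LinearMap.proj_apply, LinearMap.proj_apply,
        GForm.of_apply_self, GForm.of_apply_self, smul_eq_mul]
    · split_ifs
      · rw [LinearMap.smul_apply, LinearMap.smul_apply, LinearMap.compl₁₂_apply, LinearMap.proj_apply, LinearMap.proj_apply, GForm.of_apply_of_ne hk',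
          map_zero, LinearMap.zero_apply, smul_zero]
      · rw [LinearMap.zero_apply, LinearMap.zero_apply]
  · simp only [LinearMap.sum_apply]
    refine Finset.sum_eq_zero fun k' _ ↦ ?_
    split_ifs
    · rw [LinearMap.smul_apply, LinearMap.smul_apply, LinearMap.compl₁₂_apply, LinearMap.proj_apply, LinearMap.proj_apply]
      by_cases hk' : k' = k
      · subst hk'
        rw [GForm.of_apply_of_ne hkl y, map_zero, smul_zero]
      · rw [GForm.of_apply_of_ne hk', map_zero, LinearMap.zero_apply, smul_zero]
    · rw [LinearMap.zero_apply, LinearMap.zero_apply]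

omit [Fintype ι] [DecidableEq ι] [Nontrivial E] in
/-- An adjoint pair is detected on homogeneous elements. [folklore] -/
private theorem isAdjointPair_of_forall_of₉₁ {Q : LinearMap.BilinForm ℂ (GForm E ℂ)} {S T : Module.End ℂ (GForm E ℂ)}
    (hST : ∀ (a b : ℕ) (x : E [⋀^Fin a]→L[ℝ] ℂ) (y : E [⋀^Fin b]→L[ℝ] ℂ),
      Q (S (GForm.of a x)) (GForm.of b y) = Q (GForm.of a x) (T (GForm.of b y))) :
    LinearMap.IsAdjointPair Q Q S T := by
  intro w w'
  conv_lhs => rw [← sum_range_of_eq w, ← sum_range_of_eq w']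
  conv_rhs => rw [← sum_range_of_eq w, ← sum_range_of_eq w']
  simp only [map_sum, LinearMap.sum_apply, hST]

/-- **`(L_η, Λ_η)` is a `Q`-adjoint pair**: `Q(L w, w') = Q(w, Λ w')` — row g48-#6's `B(Lx, y) = −B(x, Λy)` together with `ε_{a+2} = −ε_a`.
[cite: Andre1996Motifs, §1.2 Prop. 1.2 (p. 11)] [cite: VoisinHodgeI2002, §7.1.2 Def. 7.7 (PDF p. 134)] -/
private theorem isAdjointPair_lefschetzG_lefschetzDualG₉₁ {g : ℕ} (e : Fin (2 * g) ≃ ι) {Q : LinearMap.BilinForm ℂ (GForm E ℂ)}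
    (hQ : ∀ (k t : ℕ) (htk : t + k = 2 * g) (x y : E [⋀^Fin k]→L[ℝ] ℂ),
      Q (GForm.of k x) (GForm.of k y) = (-1 : ℂ) ^ (k * (k - 1) / 2) * weylPairing Φ hη e htk x y)
    (hQ0 : ∀ (k l : ℕ), k ≠ l → ∀ (x : E [⋀^Fin k]→L[ℝ] ℂ) (y : E [⋀^Fin l]→L[ℝ] ℂ), Q (GForm.of k x) (GForm.of l y) = 0) :
    LinearMap.IsAdjointPair Q Q (lefschetzG η) (lefschetzDualG η) := by
  refine isAdjointPair_of_forall_of₉₁ fun a b x y ↦ ?_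
  rw [lefschetzG_of]
  by_cases hb : b = a + 2
  · subst hb
    rw [lefschetzDualG_of_add_two]
    by_cases ha : a + 2 ≤ 2 * g
    · rw [hQ (a + 2) (2 * g - (a + 2)) (by omega), hQ a (2 * g - (a + 2) + 2) (by omega),
        weylPairing_lefschetzPow_one_left Φ hη e (by omega) (by omega), neg_one_pow_half_succ_succ₉₁, neg_mul_neg]
    · have hy : y = 0 := eq_zero_of_two_mul_lt₉₁ Φ e (not_le.1 ha) y
      have hx : lefschetzPow η 1 (show 2 * 1 + a = a + 2 by omega) x = 0 := eq_zero_of_two_mul_lt₉₁ Φ e (not_le.1 ha) _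
      rw [hy, hx]
      simp only [map_zero, GForm.of_zero]
  · rw [hQ0 (a + 2) b (Ne.symm hb)]
    rcases Nat.lt_or_ge b 2 with hb2 | hb2
    · rw [lefschetzDualG_of_of_lt_two η hb2, map_zero]
    · obtain ⟨m, rfl⟩ := Nat.exists_eq_add_of_le' hb2
      rw [lefschetzDualG_of_add_two, hQ0 a m (by omega)]

/-- **`(Λ_η, L_η)` is a `Q`-adjoint pair**: `Q(Λ w, w') = Q(w, L w')` — row g48-#6's `B(Λx, y) = −B(x, Ly)` and `ε_{a+2} = −ε_a`.
[cite: Andre1996Motifs, §1.2 Prop. 1.2 (p. 11)] [cite: VoisinHodgeI2002, §7.1.2 Def. 7.7 (PDF p. 134)] -/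
private theorem isAdjointPair_lefschetzDualG_lefschetzG₉₁ {g : ℕ} (e : Fin (2 * g) ≃ ι) {Q : LinearMap.BilinForm ℂ (GForm E ℂ)}
    (hQ : ∀ (k t : ℕ) (htk : t + k = 2 * g) (x y : E [⋀^Fin k]→L[ℝ] ℂ),
      Q (GForm.of k x) (GForm.of k y) = (-1 : ℂ) ^ (k * (k - 1) / 2) * weylPairing Φ hη e htk x y)
    (hQ0 : ∀ (k l : ℕ), k ≠ l → ∀ (x : E [⋀^Fin k]→L[ℝ] ℂ) (y : E [⋀^Fin l]→L[ℝ] ℂ), Q (GForm.of k x) (GForm.of l y) = 0) :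
    LinearMap.IsAdjointPair Q Q (lefschetzDualG η) (lefschetzG η) := by
  refine isAdjointPair_of_forall_of₉₁ fun a b x y ↦ ?_
  rw [lefschetzG_of]
  rcases Nat.lt_or_ge a 2 with ha2 | ha2
  · rw [lefschetzDualG_of_of_lt_two η ha2, map_zero, LinearMap.zero_apply, hQ0 a (b + 2) (by omega)]
  · obtain ⟨m, rfl⟩ := Nat.exists_eq_add_of_le' ha2
    rw [lefschetzDualG_of_add_two]
    by_cases hb : b = m
    · subst hb
      by_cases hm : b + 2 ≤ 2 * g
      · rw [hQ b (2 * g - (b + 2) + 2) (by omega), hQ (b + 2) (2 * g - (b + 2)) (by omega),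
          weylPairing_lefschetzDual_left Φ hη e (by omega) (by omega), neg_one_pow_half_succ_succ₉₁, neg_mul, mul_neg]
      · have hx : x = 0 := eq_zero_of_two_mul_lt₉₁ Φ e (not_le.1 hm) x
        have hy : lefschetzPow η 1 (show 2 * 1 + b = b + 2 by omega) y = 0 := eq_zero_of_two_mul_lt₉₁ Φ e (not_le.1 hm) _
        rw [hx, hy]
        simp only [map_zero, GForm.of_zero, LinearMap.zero_apply]
    · rw [hQ0 m b (Ne.symm hb), hQ0 (m + 2) (b + 2) (by omega)]

/-- **`Q(w, of l y) = ε_l B_l(w_l, y)`** (`l ≤ 2g`): only the equal-degree component of `w` pairs with a homogeneous `y`. [cite: Andre1996Motifs, Prop. 1.2 (p. 11)] -/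
private theorem gradedWeylForm_apply_of₉₁ {g : ℕ} (e : Fin (2 * g) ≃ ι) {Q : LinearMap.BilinForm ℂ (GForm E ℂ)}
    (hQ : ∀ (k t : ℕ) (htk : t + k = 2 * g) (x y : E [⋀^Fin k]→L[ℝ] ℂ),
      Q (GForm.of k x) (GForm.of k y) = (-1 : ℂ) ^ (k * (k - 1) / 2) * weylPairing Φ hη e htk x y)
    (hQ0 : ∀ (k l : ℕ), k ≠ l → ∀ (x : E [⋀^Fin k]→L[ℝ] ℂ) (y : E [⋀^Fin l]→L[ℝ] ℂ), Q (GForm.of k x) (GForm.of l y) = 0)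
    (w : GForm E ℂ) {l t : ℕ} (htl : t + l = 2 * g) (y : E [⋀^Fin l]→L[ℝ] ℂ) :
    Q w (GForm.of l y) = (-1 : ℂ) ^ (l * (l - 1) / 2) * weylPairing Φ hη e htl (w l) y := by
  have hg : finrank ℂ E = g := finrank_eq_of_finTwoMulEquiv Φ e
  conv_lhs => rw [← sum_range_of_eq w]
  rw [map_sum, LinearMap.sum_apply, Finset.sum_eq_single_of_mem l (Finset.mem_range.2 (by omega)) fun a _ ha ↦ hQ0 a l ha (w a) y]
  exact hQ l t htl (w l) y

/-- **`Q(of k x, w) = ε_k B_k(x, w_k)`** (`k ≤ 2g`). [cite: Andre1996Motifs, Prop. 1.2 (p. 11)] -/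
private theorem gradedWeylForm_of_apply₉₁ {g : ℕ} (e : Fin (2 * g) ≃ ι) {Q : LinearMap.BilinForm ℂ (GForm E ℂ)}
    (hQ : ∀ (k t : ℕ) (htk : t + k = 2 * g) (x y : E [⋀^Fin k]→L[ℝ] ℂ),
      Q (GForm.of k x) (GForm.of k y) = (-1 : ℂ) ^ (k * (k - 1) / 2) * weylPairing Φ hη e htk x y)
    (hQ0 : ∀ (k l : ℕ), k ≠ l → ∀ (x : E [⋀^Fin k]→L[ℝ] ℂ) (y : E [⋀^Fin l]→L[ℝ] ℂ), Q (GForm.of k x) (GForm.of l y) = 0)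
    {k t : ℕ} (htk : t + k = 2 * g) (x : E [⋀^Fin k]→L[ℝ] ℂ) (w : GForm E ℂ) :
    Q (GForm.of k x) w = (-1 : ℂ) ^ (k * (k - 1) / 2) * weylPairing Φ hη e htk x (w k) := by
  have hg : finrank ℂ E = g := finrank_eq_of_finTwoMulEquiv Φ e
  conv_lhs => rw [← sum_range_of_eq w]
  rw [map_sum, Finset.sum_eq_single_of_mem k (Finset.mem_range.2 (by omega)) fun a _ ha ↦ hQ0 k a (Ne.symm ha) x (w a)]
  exact hQ k t htk x (w k)

/-- **`Q(w, w') = Σ_{m ≤ 2g} ε_m B_m(w_m, w'_m)`**. [cite: Andre1996Motifs, Prop. 1.2 (p. 11)] [cite: VoisinHodgeI2002, §7.1.2 Def. 7.7] -/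
private theorem gradedWeylForm_eq_sum₉₁ {g : ℕ} (e : Fin (2 * g) ≃ ι) {Q : LinearMap.BilinForm ℂ (GForm E ℂ)}
    (hQ : ∀ (k t : ℕ) (htk : t + k = 2 * g) (x y : E [⋀^Fin k]→L[ℝ] ℂ),
      Q (GForm.of k x) (GForm.of k y) = (-1 : ℂ) ^ (k * (k - 1) / 2) * weylPairing Φ hη e htk x y)
    (hQ0 : ∀ (k l : ℕ), k ≠ l → ∀ (x : E [⋀^Fin k]→L[ℝ] ℂ) (y : E [⋀^Fin l]→L[ℝ] ℂ), Q (GForm.of k x) (GForm.of l y) = 0) (w w' : GForm E ℂ) :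
    Q w w' = ∑ m : Fin (2 * g + 1), (-1 : ℂ) ^ ((m : ℕ) * ((m : ℕ) - 1) / 2) * weylPairing Φ hη e (show (2 * g - m) + (m : ℕ) = 2 * g by omega) (w m) (w' m) := by
  have hg : finrank ℂ E = g := finrank_eq_of_finTwoMulEquiv Φ e
  conv_lhs => rw [← sum_range_of_eq w']
  rw [map_sum, hg, Finset.sum_range (fun a ↦ Q w (GForm.of a (w' a)))]
  exact Finset.sum_congr rfl fun m _ ↦ by rw [gradedWeylForm_apply_of₉₁ Φ hη e hQ hQ0 w (show (2 * g - m) + (m : ℕ) = 2 * g by omega)]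

/-- **Componentwise reading of a `Q`-adjoint pair**: `ε_l B_l((S(of k x))_l, y) = ε_k B_k(x, (T(of l y))_k)`. [cite: Andre1996Motifs, Prop. 1.2 (p. 11)] -/
private theorem weylPairing_of_apply_eq_of_isAdjointPair₉₁ {g : ℕ} (e : Fin (2 * g) ≃ ι) {Q : LinearMap.BilinForm ℂ (GForm E ℂ)}
    (hQ : ∀ (k t : ℕ) (htk : t + k = 2 * g) (x y : E [⋀^Fin k]→L[ℝ] ℂ),
      Q (GForm.of k x) (GForm.of k y) = (-1 : ℂ) ^ (k * (k - 1) / 2) * weylPairing Φ hη e htk x y)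
    (hQ0 : ∀ (k l : ℕ), k ≠ l → ∀ (x : E [⋀^Fin k]→L[ℝ] ℂ) (y : E [⋀^Fin l]→L[ℝ] ℂ), Q (GForm.of k x) (GForm.of l y) = 0)
    {S T : Module.End ℂ (GForm E ℂ)} (hST : LinearMap.IsAdjointPair Q Q S T) {k l tk tl : ℕ} (htk : tk + k = 2 * g) (htl : tl + l = 2 * g)
    (x : E [⋀^Fin k]→L[ℝ] ℂ) (y : E [⋀^Fin l]→L[ℝ] ℂ) :
    (-1 : ℂ) ^ (l * (l - 1) / 2) * weylPairing Φ hη e htl (S (GForm.of k x) l) y =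
      (-1 : ℂ) ^ (k * (k - 1) / 2) * weylPairing Φ hη e htk x (T (GForm.of l y) k) := by
  rw [← gradedWeylForm_apply_of₉₁ Φ hη e hQ hQ0 _ htl y, ← gradedWeylForm_of_apply₉₁ Φ hη e hQ hQ0 htk x]
  exact hST (GForm.of k x) (GForm.of l y)

end Graded

/-! ## §1 The transpose of `ρ(γ)` for the Weyl form is `ρ(γᵀ)`; unipotents; powers; isometries -/

section Transpose

/-- **ANDRÉ'S PROPOSITION 1.2 AT THE LEVEL OF THE GROUP, ON A COMPLEX TORUS: `ε_l B_l((ρ(γ)(of k x))_l, y) = ε_k B_k(x, (ρ(γᵀ)(of l y))_k)` for every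
`γ ∈ SL₂(ℂ)`** (`x ∈ Hᵏ(X; ℂ)`, `y ∈ Hˡ(X; ℂ)`, `k, l ≤ 2g`, `B_m(u, v) = ∫_X w(u) ∧ v` the Weyl pairing, `ε_m = (−1)^{m(m−1)/2}` Voisin's sign) — for the graded Weyl–Voisin
form `Q = Σ_m ε_m B_m` the TRANSPOSE OF BEAUVILLE'S `ρ(γ)` IS `ρ(γᵀ)`: "la transposition relative à la forme bilinéaire `(x, y) ↦ ∫ x ∪ *y` correspond à la transposition
des matrices" with `* = w = ± *_H`, integrated from the generators (`Q(Lx, y) = Q(x, Λy)`, `Q(Λx, y) = Q(x, Ly)`, row g48-#6) to all of `SL₂(ℂ)` by the abstract row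
`isAdjointPair_sl2Rep_transpose`. [cite: Andre1996Motifs, §1.2 Prop. 1.2 (pp. 11–12)] [cite: Beauville2010SL2, §4 Theorem] [cite: VoisinHodgeI2002, §7.1.2 Def. 7.7 (PDF p. 134)] -/
theorem weylPairing_sl2Rep_of_apply_transpose {g : ℕ} (e : Fin (2 * g) ≃ ι) (γ : SL(2, ℂ)) {k l tk tl : ℕ} (htk : tk + k = 2 * g) (htl : tl + l = 2 * g)
    (x : E [⋀^Fin k]→L[ℝ] ℂ) (y : E [⋀^Fin l]→L[ℝ] ℂ) :
    (-1 : ℂ) ^ (l * (l - 1) / 2) * weylPairing Φ hη e htl ((hasLefschetzProperty_lefschetzG hη).sl2Rep isZGrading_countingG γ (GForm.of k x) l) y =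
      (-1 : ℂ) ^ (k * (k - 1) / 2) *
        weylPairing Φ hη e htk x ((hasLefschetzProperty_lefschetzG hη).sl2Rep isZGrading_countingG γ.transpose (GForm.of l y) k) := by
  obtain ⟨Q, hQ, hQ0⟩ := exists_gradedWeylForm₉₁ Φ hη e
  have hef := isAdjointPair_lefschetzG_lefschetzDualG₉₁ Φ hη e hQ hQ0
  have hfe := isAdjointPair_lefschetzDualG_lefschetzG₉₁ Φ hη e hQ hQ0
  rw [← dual_lefschetzG_eq_lefschetzDualG hη] at hef hfe
  exact weylPairing_of_apply_eq_of_isAdjointPair₉₁ Φ hη e hQ hQ0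
    ((hasLefschetzProperty_lefschetzG hη).isAdjointPair_sl2Rep_transpose isZGrading_countingG hef hfe γ) htk htl x y

/-- Solved form: **`B_l((ρ(γ)(of k x))_l, y) = (−1)^{l(l−1)/2 + k(k−1)/2} B_k(x, (ρ(γᵀ)(of l y))_k)`**. [cite: Andre1996Motifs, §1.2 Prop. 1.2 (pp. 11–12)]
[cite: Beauville2010SL2, §4 Theorem] -/
theorem weylPairing_sl2Rep_of_apply_eq {g : ℕ} (e : Fin (2 * g) ≃ ι) (γ : SL(2, ℂ)) {k l tk tl : ℕ} (htk : tk + k = 2 * g) (htl : tl + l = 2 * g)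
    (x : E [⋀^Fin k]→L[ℝ] ℂ) (y : E [⋀^Fin l]→L[ℝ] ℂ) :
    weylPairing Φ hη e htl ((hasLefschetzProperty_lefschetzG hη).sl2Rep isZGrading_countingG γ (GForm.of k x) l) y =
      (-1 : ℂ) ^ (l * (l - 1) / 2 + k * (k - 1) / 2) *
        weylPairing Φ hη e htk x ((hasLefschetzProperty_lefschetzG hη).sl2Rep isZGrading_countingG γ.transpose (GForm.of l y) k) := by
  have h1 := weylPairing_sl2Rep_of_apply_transpose Φ hη e γ htk htl x y
  have hε : (-1 : ℂ) ^ (l * (l - 1) / 2) * (-1 : ℂ) ^ (l * (l - 1) / 2) = 1 := by rw [← pow_add, ← two_mul, pow_mul, neg_one_sq, one_pow]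
  calc weylPairing Φ hη e htl ((hasLefschetzProperty_lefschetzG hη).sl2Rep isZGrading_countingG γ (GForm.of k x) l) y
      = (-1 : ℂ) ^ (l * (l - 1) / 2) * ((-1 : ℂ) ^ (l * (l - 1) / 2) *
          weylPairing Φ hη e htl ((hasLefschetzProperty_lefschetzG hη).sl2Rep isZGrading_countingG γ (GForm.of k x) l) y) := by
        rw [← mul_assoc, hε, one_mul]
    _ = _ := by rw [h1, ← mul_assoc, ← pow_add]

/-- **THE UNIPOTENTS: `(e^{aL_η})ᵀ = e^{aΛ_η}`** — `ε_l B_l((exp(a L_η)(of k x))_l, y) = ε_k B_k(x, (exp(a Λ_η)(of l y))_k)`: Beauville's `(1 a ; 0 1)·z = e^{aθ} z` and its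
transpose `(1 0 ; a 1)`, read for the Weyl form. [cite: Beauville2010SL2, §4 Theorem ("(1 a ; 0 1)·z = e^{aθ} z")] [cite: Andre1996Motifs, §1.2 Prop. 1.2 (p. 12, proof:
"ces générateurs s'échangent par la transposition")] -/
theorem weylPairing_exp_smul_lefschetzG_of_apply {g : ℕ} (e : Fin (2 * g) ≃ ι) (a : ℂ) {k l tk tl : ℕ} (htk : tk + k = 2 * g) (htl : tl + l = 2 * g)
    (x : E [⋀^Fin k]→L[ℝ] ℂ) (y : E [⋀^Fin l]→L[ℝ] ℂ) :
    letI := Algebra.compHom (Module.End ℂ (GForm E ℂ)) (algebraMap ℚ ℂ)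
    (-1 : ℂ) ^ (l * (l - 1) / 2) * weylPairing Φ hη e htl (IsNilpotent.exp (a • lefschetzG η) (GForm.of k x) l) y =
      (-1 : ℂ) ^ (k * (k - 1) / 2) * weylPairing Φ hη e htk x (IsNilpotent.exp (a • lefschetzDualG η) (GForm.of l y) k) := by
  have hu : ((⟨!![(1 : ℂ), a; 0, 1], by rw [Matrix.det_fin_two_of]; ring⟩ : SL(2, ℂ)) : Matrix (Fin 2) (Fin 2) ℂ) = !![1, a; 0, 1] := rfl
  have hl : (Matrix.SpecialLinearGroup.transpose (⟨!![(1 : ℂ), a; 0, 1], by rw [Matrix.det_fin_two_of]; ring⟩ : SL(2, ℂ)) : Matrix (Fin 2) (Fin 2) ℂ) =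
      !![1, 0; a, 1] := by
    rw [Matrix.SpecialLinearGroup.coe_transpose, hu]
    ext i j; fin_cases i <;> fin_cases j <;> simp
  have key := weylPairing_sl2Rep_of_apply_transpose Φ hη e (⟨!![(1 : ℂ), a; 0, 1], by rw [Matrix.det_fin_two_of]; ring⟩ : SL(2, ℂ)) htk htl x y
  rw [(hasLefschetzProperty_lefschetzG hη).sl2Rep_apply_of_coe_eq_upper isZGrading_countingG _ hu, sl2Rep_lower hη _ hl] at key
  exact key

/-- **POWERS: `(Lʲ)ᵀ = Λʲ` for the Weyl form** — `ε_l B_l(((L_η)ʲ(of k x))_l, y) = ε_k B_k(x, ((Λ_η)ʲ(of l y))_k)` (row g48-#6 iterated; `j = 1`: `Q_w(Lx, y) = Q_w(x, Λy)`).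
[cite: Andre1996Motifs, §1.2 Prop. 1.2 (p. 11)] [cite: Huybrechts2005, §1.2 Lemma 1.2.23] -/
theorem weylPairing_lefschetzG_pow_of_apply {g : ℕ} (e : Fin (2 * g) ≃ ι) (j : ℕ) {k l tk tl : ℕ} (htk : tk + k = 2 * g) (htl : tl + l = 2 * g)
    (x : E [⋀^Fin k]→L[ℝ] ℂ) (y : E [⋀^Fin l]→L[ℝ] ℂ) :
    (-1 : ℂ) ^ (l * (l - 1) / 2) * weylPairing Φ hη e htl ((lefschetzG η ^ j) (GForm.of k x) l) y =
      (-1 : ℂ) ^ (k * (k - 1) / 2) * weylPairing Φ hη e htk x ((lefschetzDualG η ^ j) (GForm.of l y) k) := by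
  obtain ⟨Q, hQ, hQ0⟩ := exists_gradedWeylForm₉₁ Φ hη e
  exact weylPairing_of_apply_eq_of_isAdjointPair₉₁ Φ hη e hQ hQ0 (isAdjointPair_pow (isAdjointPair_lefschetzG_lefschetzDualG₉₁ Φ hη e hQ hQ0) j) htk htl x y

/-- **`(Λʲ)ᵀ = Lʲ` for the Weyl form** — `ε_l B_l(((Λ_η)ʲ(of k x))_l, y) = ε_k B_k(x, ((L_η)ʲ(of l y))_k)`. [cite: Andre1996Motifs, §1.2 Prop. 1.2 (p. 11)]
[cite: Huybrechts2005, §1.2 Lemma 1.2.23] -/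
theorem weylPairing_lefschetzDualG_pow_of_apply {g : ℕ} (e : Fin (2 * g) ≃ ι) (j : ℕ) {k l tk tl : ℕ} (htk : tk + k = 2 * g) (htl : tl + l = 2 * g)
    (x : E [⋀^Fin k]→L[ℝ] ℂ) (y : E [⋀^Fin l]→L[ℝ] ℂ) :
    (-1 : ℂ) ^ (l * (l - 1) / 2) * weylPairing Φ hη e htl ((lefschetzDualG η ^ j) (GForm.of k x) l) y =
      (-1 : ℂ) ^ (k * (k - 1) / 2) * weylPairing Φ hη e htk x ((lefschetzG η ^ j) (GForm.of l y) k) := by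
  obtain ⟨Q, hQ, hQ0⟩ := exists_gradedWeylForm₉₁ Φ hη e
  exact weylPairing_of_apply_eq_of_isAdjointPair₉₁ Φ hη e hQ hQ0 (isAdjointPair_pow (isAdjointPair_lefschetzDualG_lefschetzG₉₁ Φ hη e hQ hQ0) j) htk htl x y

/-- **`ρ(γ)` IS A `Q`-ISOMETRY FOR `γᵀγ = 1`: `Σ_{m ≤ 2g} ε_m B_m((ρ(γ)(of k x))_m, (ρ(γ)(of l y))_m) = ε_k B_k(x, y)` if `k = l`, and `= 0` if `k ≠ l`** — the orthogonal elements of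
`SL₂(ℂ)` (the Weyl element `(0 −1 ; 1 0)`: row g48-#4's `Q_w(wx, wy) = Q_w(x, y)`; the centre `−1`; the rotations `(a −b ; b a)`, `a² + b² = 1`) preserve the graded Weyl–Voisin
form. [cite: Andre1996Motifs, §1.2 Prop. 1.2 (pp. 11–12)] [cite: Lange2023AbelianVarietiesComplex, §6.2.4 Prop. 6.2.20 (p. 310, Parseval)] [cite: LooijengaLunts1997, §1 (1.3) p. 5] -/
theorem sum_weylPairing_sl2Rep_sl2Rep_eq {g : ℕ} (e : Fin (2 * g) ≃ ι) {γ : SL(2, ℂ)} (hγ : γ.transpose * γ = 1) {k l tk : ℕ} (htk : tk + k = 2 * g)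
    (x : E [⋀^Fin k]→L[ℝ] ℂ) (y : E [⋀^Fin l]→L[ℝ] ℂ) :
    ∑ m : Fin (2 * g + 1), (-1 : ℂ) ^ ((m : ℕ) * ((m : ℕ) - 1) / 2) * weylPairing Φ hη e (show (2 * g - m) + (m : ℕ) = 2 * g by omega)
        ((hasLefschetzProperty_lefschetzG hη).sl2Rep isZGrading_countingG γ (GForm.of k x) m)
        ((hasLefschetzProperty_lefschetzG hη).sl2Rep isZGrading_countingG γ (GForm.of l y) m) =
      if h : k = l then (-1 : ℂ) ^ (k * (k - 1) / 2) * weylPairing Φ hη e htk x (h ▸ y) else 0 := by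
  obtain ⟨Q, hQ, hQ0⟩ := exists_gradedWeylForm₉₁ Φ hη e
  have hef := isAdjointPair_lefschetzG_lefschetzDualG₉₁ Φ hη e hQ hQ0
  have hfe := isAdjointPair_lefschetzDualG_lefschetzG₉₁ Φ hη e hQ hQ0
  rw [← dual_lefschetzG_eq_lefschetzDualG hη] at hef hfe
  have key := (hasLefschetzProperty_lefschetzG hη).isOrthogonal_sl2Rep_of_transpose_mul_self isZGrading_countingG hef hfe hγ (GForm.of k x) (GForm.of l y)
  rw [gradedWeylForm_eq_sum₉₁ Φ hη e hQ hQ0] at key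
  rw [key]
  split_ifs with h
  · subst h
    exact hQ k tk htk x y
  · exact hQ0 k l h x y

end Transpose

/-! ## §2 The degree-`0` part of `ℂ[L_η, Λ_η]` is `Q_w`-self-adjoint -/

section Diagonal

/-- **EVERY ELEMENT OF `ℂ[L_η, Λ_η]` COMMUTING WITH `H` IS SELF-ADJOINT FOR THE WEYL PAIRING, IN EVERY DEGREE**: for `T ∈ ℂ[L_η, Λ_η] ⊂ End H•(X; ℂ)` with `[H, T] = 0`
and `x, y ∈ Hᵏ(X; ℂ)` (`k ≤ 2g`), `B_k((T(of k x))_k, y) = B_k(x, (T(of k y))_k)` — such `T` act by a scalar on every piece `Lʳ P^{m}` (Kleiman's `pʲ`, the Lefschetz–Künneth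
projectors `π_{s,r}` of row g48-#9, `w² = (−1)^{H}`, the Casimir), and the pieces are `Q`-orthogonal (abstract row `isSelfAdjoint_of_mem_adjoin_pair_dual_of_commute`):
André's "contiennent les projecteurs de Künneth" + "la transposition […] correspond à la transposition des matrices" ⇒ the diagonal elements are symmetric.
[cite: Andre1996Motifs, §1.2 Prop. 1.2 (pp. 11–12)] [cite: Kleiman1968AlgebraicCycles, §1.4 (1.4.4–1.4.5)] -/
theorem weylPairing_apply_of_eq_of_mem_adjoin_pair_of_commute {g : ℕ} (e : Fin (2 * g) ≃ ι) {T : Module.End ℂ (GForm E ℂ)}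
    (hT : T ∈ Algebra.adjoin ℂ ({lefschetzG η, lefschetzDualG η} : Set (Module.End ℂ (GForm E ℂ)))) (hTh : Commute (countingG E) T)
    {k tk : ℕ} (htk : tk + k = 2 * g) (x y : E [⋀^Fin k]→L[ℝ] ℂ) :
    weylPairing Φ hη e htk (T (GForm.of k x) k) y = weylPairing Φ hη e htk x (T (GForm.of k y) k) := by
  obtain ⟨Q, hQ, hQ0⟩ := exists_gradedWeylForm₉₁ Φ hη e
  have hef := isAdjointPair_lefschetzG_lefschetzDualG₉₁ Φ hη e hQ hQ0
  have hfe := isAdjointPair_lefschetzDualG_lefschetzG₉₁ Φ hη e hQ hQ0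
  rw [← dual_lefschetzG_eq_lefschetzDualG hη] at hef hfe hT
  have hTT := (hasLefschetzProperty_lefschetzG hη).isSelfAdjoint_of_mem_adjoin_pair_dual_of_commute isZGrading_countingG hef hfe hT hTh
  have h1 := weylPairing_of_apply_eq_of_isAdjointPair₉₁ Φ hη e hQ hQ0 hTT htk htk x y
  exact mul_left_cancel₀ (pow_ne_zero _ (neg_ne_zero.2 one_ne_zero)) h1

omit [Fintype ι] in
/-- Off the diagonal such `T` pair to zero: **`B_l((T(of k x))_l, y) = 0` for `k ≠ l`** (`T` preserves degrees). [cite: Andre1996Motifs, §1.2 Prop. 1.2 (pp. 11–12)] -/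
theorem weylPairing_apply_of_eq_zero_of_commute {g : ℕ} (e : Fin (2 * g) ≃ ι) {T : Module.End ℂ (GForm E ℂ)} (hTh : Commute (countingG E) T)
    {k l tl : ℕ} (hkl : k ≠ l) (htl : tl + l = 2 * g) (x : E [⋀^Fin k]→L[ℝ] ℂ) (y : E [⋀^Fin l]→L[ℝ] ℂ) :
    weylPairing Φ hη e htl (T (GForm.of k x) l) y = 0 := by
  have hmem : T (GForm.of k x) ∈ degreeSpace (countingG E) ((k : ℤ) - (finrank ℂ E : ℤ)) := by
    have hx := mem_degreeSpace_iff.1 (of_mem_degreeSpace_countingG (E := E) k x)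
    rw [mem_degreeSpace_iff, ← Module.End.mul_apply, hTh.eq, Module.End.mul_apply, hx, map_smul]
  rw [(mem_degreeSpace_countingG_iff.1 hmem) l (Ne.symm hkl), map_zero, LinearMap.zero_apply]

end Diagonal

/-! ## §3 On `H•(X, ℚ)`: `Q_w((ρ(γ)x)_l, y) = Q_w(x, (ρ(γᵀ)y)_k)` for `γ ∈ SL₂(ℚ)` — no sign at all -/

section Rational

omit [Fintype ι] [DecidableEq ι] [NormedAddCommGroup E] [NormedSpace ℂ E] [FiniteDimensional ℂ E] [Nontrivial E] in
/-- `(γ ⊗ ℂ)ᵀ = γᵀ ⊗ ℂ` for `γ ∈ SL(2, ℚ)`. [folklore] -/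
private theorem transpose_map_ratCast₉₁ (γ : SL(2, ℚ)) :
    (Matrix.SpecialLinearGroup.map (Rat.castHom ℂ) γ).transpose = Matrix.SpecialLinearGroup.map (Rat.castHom ℂ) γ.transpose :=
  Subtype.ext (by
    rw [Matrix.SpecialLinearGroup.coe_transpose]
    ext i j
    rfl)

/-- **`ρ(γ)` is defined over `ℚ` for `γ ∈ SL₂(ℚ)`**: `(ρ(γ)(of k x))_m ∈ Hᵐ(X, ℚ)` for `x ∈ Hᵏ(X, ℚ)` and `η ∈ NS(X) ⊗ ℚ` (p09's `sl2Rep_map_ratCast_mem_rationalEnd`, read on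
components). [cite: LooijengaLunts1997, §1 (1.7) p. 6] [cite: Beauville2010SL2, §4 Theorem] -/
theorem sl2Rep_map_ratCast_of_apply_mem_rationalForms (hQ : η ∈ neronSeveriQ Φ) (hη : ∀ v : E, v ≠ 0 → ∃ w : E, η ![v, w] ≠ 0) (γ : SL(2, ℚ)) {k : ℕ}
    {x : E [⋀^Fin k]→L[ℝ] ℂ} (hx : x ∈ rationalForms Φ k) (m : ℕ) :
    (hasLefschetzProperty_lefschetzG hη).sl2Rep isZGrading_countingG (Matrix.SpecialLinearGroup.map (Rat.castHom ℂ) γ) (GForm.of k x) m ∈ rationalForms Φ m :=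
  (mem_rationalFormsG_iff Φ).1 (sl2Rep_map_ratCast_apply_mem_rationalFormsG Φ hQ hη γ (of_mem_rationalFormsG Φ hx)) m

/-- **ANDRÉ'S PROP. 1.2 FOR VOISIN'S `Q_w` ON `H•(X, ℚ)`: `Q_w((ρ(γ)x)_l, y) = Q_w(x, (ρ(γᵀ)y)_k)` for every `γ ∈ SL₂(ℚ)`**, `x ∈ Hᵏ(X, ℚ)`, `y ∈ Hˡ(X, ℚ)` (`k, l ≤ 2g`,
`η ∈ NS(X) ⊗ ℚ` non-degenerate) — TRANSPOSITION FOR THE WEYL POLARIZATION FORM IS MATRIX TRANSPOSITION, with no residual sign (Voisin's `(−1)^{k(k−1)/2}` is built into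
`Q_w = weylPolarizationForm`). [cite: Andre1996Motifs, §1.2 Prop. 1.2 (pp. 11–12)] [cite: VoisinHodgeI2002, §7.1.2 Def. 7.7 (PDF p. 134)] [cite: Beauville2010SL2, §4 Theorem] -/
theorem weylPolarizationForm_sl2Rep_of_apply_transpose (hQ : η ∈ neronSeveriQ Φ) (hη : ∀ v : E, v ≠ 0 → ∃ w : E, η ![v, w] ≠ 0) {g : ℕ} (e : Fin (2 * g) ≃ ι)
    (γ : SL(2, ℚ)) {k l tk tl : ℕ} (htk : tk + k = 2 * g) (htl : tl + l = 2 * g) (x : rationalForms Φ k) (y : rationalForms Φ l) :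
    weylPolarizationForm Φ hQ hη e htl
        ⟨(hasLefschetzProperty_lefschetzG hη).sl2Rep isZGrading_countingG (Matrix.SpecialLinearGroup.map (Rat.castHom ℂ) γ) (GForm.of k (x : E [⋀^Fin k]→L[ℝ] ℂ)) l,
          sl2Rep_map_ratCast_of_apply_mem_rationalForms Φ hQ hη γ x.2 l⟩ y =
      weylPolarizationForm Φ hQ hη e htk x
        ⟨(hasLefschetzProperty_lefschetzG hη).sl2Rep isZGrading_countingG (Matrix.SpecialLinearGroup.map (Rat.castHom ℂ) γ.transpose)
            (GForm.of l (y : E [⋀^Fin l]→L[ℝ] ℂ)) k,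
          sl2Rep_map_ratCast_of_apply_mem_rationalForms Φ hQ hη γ.transpose y.2 k⟩ := by
  apply Rat.cast_injective (α := ℂ)
  rw [coe_weylPolarizationForm, coe_weylPolarizationForm, Submodule.coe_mk, Submodule.coe_mk]
  have key := weylPairing_sl2Rep_of_apply_transpose Φ hη e (Matrix.SpecialLinearGroup.map (Rat.castHom ℂ) γ) htk htl (x : E [⋀^Fin k]→L[ℝ] ℂ)
    (y : E [⋀^Fin l]→L[ℝ] ℂ)
  rw [transpose_map_ratCast₉₁] at key
  exact key

/-- The same for `η ∈ NS(X)` a non-degenerate integral `(1,1)`-class. [cite: Andre1996Motifs, §1.2 Prop. 1.2 (pp. 11–12)] [cite: VoisinHodgeI2002, §7.1.2 Def. 7.7 (PDF p. 134)] -/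
theorem IsNSForm.weylPolarizationForm_sl2Rep_of_apply_transpose (hNS : IsNSForm Φ η) (hη : ∀ v : E, v ≠ 0 → ∃ w : E, η ![v, w] ≠ 0) {g : ℕ}
    (e : Fin (2 * g) ≃ ι) (γ : SL(2, ℚ)) {k l tk tl : ℕ} (htk : tk + k = 2 * g) (htl : tl + l = 2 * g) (x : rationalForms Φ k) (y : rationalForms Φ l) :
    weylPolarizationForm Φ (mem_neronSeveriQ_of_isNSForm Φ hNS) hη e htl
        ⟨(hasLefschetzProperty_lefschetzG hη).sl2Rep isZGrading_countingG (Matrix.SpecialLinearGroup.map (Rat.castHom ℂ) γ) (GForm.of k (x : E [⋀^Fin k]→L[ℝ] ℂ)) l,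
          sl2Rep_map_ratCast_of_apply_mem_rationalForms Φ (mem_neronSeveriQ_of_isNSForm Φ hNS) hη γ x.2 l⟩ y =
      weylPolarizationForm Φ (mem_neronSeveriQ_of_isNSForm Φ hNS) hη e htk x
        ⟨(hasLefschetzProperty_lefschetzG hη).sl2Rep isZGrading_countingG (Matrix.SpecialLinearGroup.map (Rat.castHom ℂ) γ.transpose)
            (GForm.of l (y : E [⋀^Fin l]→L[ℝ] ℂ)) k,
          sl2Rep_map_ratCast_of_apply_mem_rationalForms Φ (mem_neronSeveriQ_of_isNSForm Φ hNS) hη γ.transpose y.2 k⟩ :=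
  ComplexTorus.weylPolarizationForm_sl2Rep_of_apply_transpose Φ (mem_neronSeveriQ_of_isNSForm Φ hNS) hη e γ htk htl x y

omit [Fintype ι] [DecidableEq ι] [NormedAddCommGroup E] [NormedSpace ℂ E] [FiniteDimensional ℂ E] [Nontrivial E] in
/-- `γ ∈ SL(2, ℤ)` read in `SL(2, ℂ)` is `γ ⊗ ℚ` read in `SL(2, ℂ)`. [folklore] -/
private theorem intCast_eq_map_ratCast_map₉₁ (γ : SL(2, ℤ)) :
    (γ : SL(2, ℂ)) = Matrix.SpecialLinearGroup.map (Rat.castHom ℂ) (Matrix.SpecialLinearGroup.map (Int.castRingHom ℚ) γ) := by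
  ext i j
  simp

omit [Fintype ι] [DecidableEq ι] [NormedAddCommGroup E] [NormedSpace ℂ E] [FiniteDimensional ℂ E] [Nontrivial E] in
/-- `(γᵀ : SL(2, ℂ)) = (γ : SL(2, ℂ))ᵀ` for `γ ∈ SL(2, ℤ)`. [folklore] -/
private theorem intCast_transpose₉₁ (γ : SL(2, ℤ)) : ((γ.transpose : SL(2, ℤ)) : SL(2, ℂ)) = (γ : SL(2, ℂ)).transpose := by
  ext i j
  simp [Matrix.SpecialLinearGroup.transpose]

/-- **`(ρ(γ)(of k x))_m ∈ Hᵐ(X, ℚ)` for `γ ∈ SL₂(ℤ)`**, `x ∈ Hᵏ(X, ℚ)`. [cite: Beauville2010SL2, §4 Theorem] [cite: LooijengaLunts1997, §1 (1.7) p. 6] -/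
theorem sl2Rep_intCast_of_apply_mem_rationalForms (hQ : η ∈ neronSeveriQ Φ) (hη : ∀ v : E, v ≠ 0 → ∃ w : E, η ![v, w] ≠ 0) (γ : SL(2, ℤ)) {k : ℕ}
    {x : E [⋀^Fin k]→L[ℝ] ℂ} (hx : x ∈ rationalForms Φ k) (m : ℕ) :
    (hasLefschetzProperty_lefschetzG hη).sl2Rep isZGrading_countingG (γ : SL(2, ℂ)) (GForm.of k x) m ∈ rationalForms Φ m :=
  (mem_rationalFormsG_iff Φ).1 ((mem_rationalEnd_iff Φ).1 (sl2Rep_map_intCast_mem_rationalEnd Φ hQ hη γ) _ (of_mem_rationalFormsG Φ hx)) m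

/-- **`Q_w((ρ(γ)x)_l, y) = Q_w(x, (ρ(γᵀ)y)_k)` for `γ ∈ SL₂(ℤ)`** — Beauville's arithmetic group `SL₂(ℤ)` acting on `H•(X, ℚ)`; e.g. `γ = (0 −1 ; 1 0)`: `Q_w(wx, y) = Q_w(x, w⁻¹y)`
(row g48-#6), `γ = (1 1 ; 0 1)`: `Q_w(e^{L}x, y) = Q_w(x, e^{Λ}y)`. [cite: Beauville2010SL2, §4 Theorem] [cite: Andre1996Motifs, §1.2 Prop. 1.2 (pp. 11–12)]
[cite: VoisinHodgeI2002, §7.1.2 Def. 7.7 (PDF p. 134)] -/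
theorem weylPolarizationForm_sl2Rep_intCast_of_apply_transpose (hQ : η ∈ neronSeveriQ Φ) (hη : ∀ v : E, v ≠ 0 → ∃ w : E, η ![v, w] ≠ 0) {g : ℕ}
    (e : Fin (2 * g) ≃ ι) (γ : SL(2, ℤ)) {k l tk tl : ℕ} (htk : tk + k = 2 * g) (htl : tl + l = 2 * g) (x : rationalForms Φ k) (y : rationalForms Φ l) :
    weylPolarizationForm Φ hQ hη e htl
        ⟨(hasLefschetzProperty_lefschetzG hη).sl2Rep isZGrading_countingG (γ : SL(2, ℂ)) (GForm.of k (x : E [⋀^Fin k]→L[ℝ] ℂ)) l,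
          sl2Rep_intCast_of_apply_mem_rationalForms Φ hQ hη γ x.2 l⟩ y =
      weylPolarizationForm Φ hQ hη e htk x
        ⟨(hasLefschetzProperty_lefschetzG hη).sl2Rep isZGrading_countingG ((γ.transpose : SL(2, ℤ)) : SL(2, ℂ)) (GForm.of l (y : E [⋀^Fin l]→L[ℝ] ℂ)) k,
          sl2Rep_intCast_of_apply_mem_rationalForms Φ hQ hη γ.transpose y.2 k⟩ := by
  apply Rat.cast_injective (α := ℂ)
  rw [coe_weylPolarizationForm, coe_weylPolarizationForm, Submodule.coe_mk, Submodule.coe_mk]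
  have key := weylPairing_sl2Rep_of_apply_transpose Φ hη e (γ : SL(2, ℂ)) htk htl (x : E [⋀^Fin k]→L[ℝ] ℂ) (y : E [⋀^Fin l]→L[ℝ] ℂ)
  rw [← intCast_transpose₉₁] at key
  exact key

end Rational

end ComplexTorus

end Literature.Geometry.Kaehler
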